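import Literature.NumberTheory.EllipticCurves.BurungaleSkinnerTianWan2024.OrdinaryTwoVariableMainStatementSemistableOPEN
import Literature.NumberTheory.EllipticCurves.BurungaleSkinnerTianWan2024.OrdinaryMainStatementSemistableOfSkinnerUrbanProofs
import Literature.NumberTheory.EllipticCurves.BurungaleSkinnerTianWan2024.OrdinaryMainStatementTwistOfSkinnerUrbanProofs
import Literature.NumberTheory.EllipticCurves.BurungaleSkinnerTianWan2024.GreenbergMainStatementOrdinaryProofs
import Literature.NumberTheory.EllipticCurves.YanZhu2026.TwistGoodOrdinaryProofs
import Literature.NumberTheory.EllipticCurves.BurungaleCastellaSkinner2025.OrdinaryGreenbergEquivalence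
import Literature.NumberTheory.EllipticCurves.LeadingTermPPartProofs
import HarnessLib

/-!
# BSTW arXiv:2409.01350v2, the proof template of Thm. 10.8 / 10.10 (b) at `∘ = ∅` — the two-variable
# upgrade "divisibility ⟹ equality" and "9.10-`∅` ⟹ 9.12-`∅`" as KERNEL THEOREMS over refereed print,
# pointwise layer (proofs only)

A *proofs* file (theorems only: no definition, no named fact, no instance, no `sorry`) written by the
typer seat `bsd-littype-01` (gen 8) of the cross-ladder literature-typing layer (D-0088(4); cell
`run/shared/lean/pub/bsd-littype/`). It is the POINTWISE layer of the kernel replay of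
Burungale–Skinner–Tian–Wan, arXiv:2409.01350v2 (PREPRINT), Thm. 10.10 (b) ("One may proceed just as in
the proof of Theorem 10.8", p. 89, tex l.7528; template = proof of Thm. 10.8, pp. 88–89, l.7496–7514)
for `g = f_E`: every step of the template EXCEPT the two-variable divisibility of Thm. 10.5 is refereed
print already in the tree, and this file assembles those steps with the divisibility as a POINTWISE
hypothesis `hdiv : Char(X) ⊂ (𝓛)` (`IdealLeSpan`). The companion
`OrdinaryTwoVariableMainStatementReplayProofs.lean` (gen 8) feeds `hdiv` from the gen-8 binder
`thm105_ordinary_twoVariableDivisibility_OPEN` by name and states the sibling binders' conclusions.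
HONEST FRAMING: typed ≠ proved ≠ endorsed; nothing here proves BSD or a main "conj."; every theorem
is CONDITIONAL on the named binders / facts it lists.

## Step ↦ tree object (proof of Thm. 10.8, l.7496–7514, read at `∘ = ∅`)
* "Since Theorem 10.3 [ordinary: 10.10 (a)] applies to `g` as well as `g ⊗ χ_L`" ↦ the integral
  cyclotomic main statements in the Néron normalisation `CharIdealEqPadicLFunctionNeron W p` /
  `CharIdealEqPadicLFunctionNeron W' p` (`W'` a globally minimal model of `E^L = E^{(D_L)}`) — §2 takes
  them as hypotheses; §3 feeds them from the gen-6 OPEN binders O1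
  `thm1010a_mainStatement_semistable_ordinary_OPEN` / O2 `thm1010_twist_mainStatement_OPEN`, or from
  [SU14] Thm. 3.6.9 through the ARM-P reader's `…_of_skinnerUrban` theorems;
* "by Lemma 9.17" ↦ Yan–Zhu 2026 Lemma 5.3 (`lemma53_charIdeal_mul_charIdeal_le_toPlus_charIdeal`,
  Selmer side) + Prop. 3.7 at print strength (`prop37_cycRestrict_perrinRiou_eq_padicLFunction_mul`,
  analytic side) — REFEREED named facts (J. Algebra 693);
* "Theorem 10.5 gives the two-variable divisibility" ↦ `hdiv` (pointwise here);
* "noting the non-vanishing of `𝓛_p^{cyc}`" ↦ Rohrlich, tree THEOREM `padicLFunction_unitRoot_ne_zero`,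
  and the rational period ratios `ϖ · Ω_E = Ω⁺_f ≠ 0` (Edixhoven; tree THEOREM
  `ModularParametrizationData.exists_rat_mul_realPeriodRat_eq_plusPeriod`);
* "(cf. [SU, Lem. 3.2])" ↦ Skinner–Urban Lemma 3.1.7, tree THEOREM
  `IwasawaAlgebra₂.spanLeIdeal_of_idealLeSpan_of_cycRestrict_eq` (cell `bsd-littype-04`);
* statement 9.10 (a) (torsion) ↦ Yan–Zhu Cor. 2.9 (`cor29_XOrd₂_isTorsion`, REFEREED, flag-free) — §1;
* "the `In particular' part is a consequence of Proposition 9.20" (9.12-`∅`) ↦ Yan–Zhu Thm. 4.7 at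
  `S = {1}` (`thm47_ord_localised_iff_greenbergAnyRoot_localised`, "essentially [BSTW, Prop. 9.18]") +
  BCS25 Thm. 4.1.3 (`thm413_ord_torsion_dvd_iff_greenberg_torsion_dvd`, torsion transfer) — §4.
Side conditions are DISCHARGED from the block `Thm1010bHypotheses W p N K` (§0): `D_L` odd ⟹
square-free fundamental `≡ 1 (mod 4)`, `≠ 1` (`Quadratic.isFundamentalDiscriminant_discr`); `p ∤ D_L`;
ramified primes of `L` are `≠ p` and prime to `N`; (irr_L) ⟹ irreducible `G_K`-module
(`hasIrreducibleModPGaloisRep_of_forall_isAbsolutelyIrreducible`); a minimal model of `E^{(D_L)}`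
(`exists_isGloballyMinimal_smul_eq_quadraticTwist`) good ordinary at `p`
(`isOrdinaryAt_of_smul_eq_quadraticTwist_discr`); Selmer dual data over `ℚ_∞`
(`nonempty_selmerDualData_holds`, transported by `IsogenySelmerInfty.exists_selmerDualData_of_smul_eq`);
modular parametrisations (`nonempty_modularParametrizationData`).

## Hypotheses versus print (numbers, not adjectives)
The Selmer-side factorisation and Prop. 3.7 are printed on THE cyclotomic/anticyclotomic coordinates
of `Λ_L` with `γ₁|_{ℚ_∞}` the normalised generator of `Gal(ℚ_∞/ℚ)` (`κ.IsTopGenerator (absGaloisRestrict ℚ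
K γ₁)`, `IsCyclotomicVariable p (absGaloisRestrict ℚ K γ₁)` for the cyclotomic `κ` of `ℚ`); the theorems
below carry exactly these coordinate hypotheses, §4 in addition `D_L ≠ −3` (the field `discr_ne` of
Yan–Zhu's `GreenbergSetting`). Never stronger than print. Net: 0 definitions, 0 facts.

## References
* [BurungaleSkinnerTianWan2024] arXiv:2409.01350v2: proof of Thm. 10.8 (pp. 88–89; l.7496–7514), Thm.
  10.10 (b) (p. 89; l.7519–7530), Thm. 10.5 (pp. 87–88), Lemma 9.17 (p. 82), Prop. 9.18 / 9.20
  (pp. 83–84), statements 9.10 / 9.12 (p. 81).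
* [YanZhu2024MainConjNonCM] J. Algebra 693 (2026) = arXiv:2412.20078v4: Cor. 2.9, Prop. 3.7, Thm. 4.7,
  Lemma 5.3, and the proof of Thm. 4.2, last paragraph (the same Skinner–Urban step).
* [BurungaleCastellaSkinner2025] IMRN 2025 = arXiv:2405.00270v2, Thm. 4.1.3.
* [SkinnerUrban2014] Invent. Math. 195 (2014), Lemma 3.1.7 (p. 20), Thm. 3.6.9, p. 45.
* [RohrlichInventiones1984] Theorem (p. 409). [EdixhovenManin1991] §1. [GreenbergVatsal2000] §3 Rem. 3.4.
-/

noncomputable section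

open scoped Classical

open PowerSeries NumberField IsDedekindDomain Field CongruenceSubgroup
  Literature.NumberTheory.GaloisRepresentations Literature.NumberTheory.EllipticCurves
  Literature.NumberTheory.EllipticCurves.ModularForms Literature.NumberTheory.EllipticCurves.Rank1Residual

namespace Literature.NumberTheory.EllipticCurves.BurungaleSkinnerTianWan2024

open IwasawaAlgebra₂ YanZhu2026 BurungaleCastellaSkinner2025 SkinnerUrban2014
  Literature.NumberTheory.Automorphic

variable {p : ℕ} [Fact p.Prime]

/-! ## §0. Read-outs of the hypothesis block of Thm. 10.5 / 10.10 (b) -/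

/-- `p ≠ 2` prime ⟹ `3 ≤ p`. [folklore] -/
private theorem three_le_of_ne_two (h : p ≠ 2) : 3 ≤ p := by
  have := (Fact.out : p.Prime).two_le
  omega

section Readouts

variable {W : WeierstrassCurve ℚ} [W.IsGloballyMinimal] {N : ℕ} {K : Type} [Field K] [NumberField K]

/-- Under the block, `3 ≤ p`. [cite: BurungaleSkinnerTianWan2024, Thm. 10.10 (p. 89) ("p ∤ 2N") (bookkeeping)] -/
theorem Thm1010bHypotheses.three_le (h : Thm1010bHypotheses W p N K) : 3 ≤ p :=
  three_le_of_ne_two h.two_ne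

/-- Under the block, (irr_L) in the tree's unframed spelling: `E[p]` is an irreducible `G_K`-module
(`hasIrreducibleModPGaloisRep_of_forall_isAbsolutelyIrreducible`). [cite: BurungaleSkinnerTianWan2024, (irr_L) (tex l.1265) (bookkeeping)] -/
theorem Thm1010bHypotheses.irrK [W.IsElliptic] (h : Thm1010bHypotheses W p N K) :
    (W.baseChange K).HasIrreducibleModPGaloisRep p :=
  hasIrreducibleModPGaloisRep_of_forall_isAbsolutelyIrreducible (W.baseChange K) p h.irrL

/-- Under the block, `(N, D_L) = 1`. [cite: BurungaleSkinnerTianWan2024, Thm. 10.5 / 10.10 ("(D_L, 2N) = 1") (bookkeeping)] -/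
theorem Thm1010bHypotheses.coprime_level (h : Thm1010bHypotheses W p N K) :
    IsCoprime (N : ℤ) (NumberField.discr K) :=
  h.coprime.of_mul_left_right

/-- Under the block, `D_L` is odd. [cite: BurungaleSkinnerTianWan2024, Thm. 10.5 / 10.10 ("(D_L, 2N) = 1") (bookkeeping)] -/
theorem Thm1010bHypotheses.discr_odd (h : Thm1010bHypotheses W p N K) : Odd (NumberField.discr K) := by
  have h2 : IsCoprime (2 : ℤ) (NumberField.discr K) := h.coprime.of_mul_left_left
  rw [← Int.not_even_iff_odd, even_iff_two_dvd]
  intro hdvd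
  exact Int.prime_two.not_unit (h2.isUnit_of_dvd' (dvd_refl _) hdvd)

/-- Under the block, `D_L` is a square-free fundamental discriminant `≡ 1 (mod 4)`, `≠ 1` (odd case of
`Quadratic.isFundamentalDiscriminant_discr`). [cite: BurungaleSkinnerTianWan2024, Thm. 10.5 / 10.10 ("(D_L, 2N) = 1") (bookkeeping)] -/
theorem Thm1010bHypotheses.discr_squarefree (h : Thm1010bHypotheses W p N K) :
    Squarefree (NumberField.discr K) ∧ NumberField.discr K ≠ 1 ∧ NumberField.discr K % 4 = 1 := by
  rcases Literature.NumberTheory.QuadraticFields.Quadratic.isFundamentalDiscriminant_discr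
      h.isImaginaryQuadratic.finrank_eq_two with ⟨h1, hsq, hne⟩ | ⟨h4, -, -⟩
  · exact ⟨hsq, hne, h1⟩
  · exfalso
    have hodd := h.discr_odd
    rw [← Int.not_even_iff_odd] at hodd
    obtain ⟨k, hk⟩ := h4
    exact hodd ⟨2 * k, by omega⟩

/-- Under the block, `p ∤ D_L` ((ord): `p` splits). [cite: BurungaleSkinnerTianWan2024, (ord) = (2.15) (tex l.1810) (bookkeeping)] -/
theorem Thm1010bHypotheses.not_dvd_discr (h : Thm1010bHypotheses W p N K) :
    ¬ (p : ℤ) ∣ NumberField.discr K :=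
  not_dvd_discr_of_ncard_primesOver_eq_two h.isImaginaryQuadratic.finrank_eq_two Fact.out h.split

/-- Under the block, every prime ramified in `L = ℚ(√D_L)` (in the elementary spelling
`RamifiedInQuadratic D_L q`) is `≠ p` and prime to the conductor — the side condition "`(D_K, Np) = 1`"
of the sibling twist binders, for `K := L`. [cite: BurungaleSkinnerTianWan2024, Thm. 10.10, last sentence ("(D_K, Np) = 1") (bookkeeping)] -/
theorem Thm1010bHypotheses.ramifiedInQuadratic_discr (h : Thm1010bHypotheses W p N K) (q : ℕ)
    [hq : Fact q.Prime] (hram : RamifiedInQuadratic (NumberField.discr K) q) :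
    q ≠ p ∧ ¬ q ∣ W.conductorNorm ℤ := by
  obtain ⟨-, -, h1⟩ := h.discr_squarefree
  have hqd : (q : ℤ) ∣ NumberField.discr K := by
    rcases hram with hdvd | ⟨-, h4⟩
    · exact hdvd
    · exact absurd h1 h4
  refine ⟨?_, fun hqN ↦ ?_⟩
  · rintro rfl
    exact h.not_dvd_discr hqd
  · have hqN' : (q : ℤ) ∣ (N : ℤ) := by
      rw [h.level]
      exact_mod_cast hqN
    have hu : IsUnit (q : ℤ) := h.coprime_level.isUnit_of_dvd' hqN' hqd
    have h2 := hq.out.two_le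
    rcases Int.isUnit_iff.mp hu with h1' | h1' <;> omega

end Readouts

/-! ## §1. Statement 9.10 (a), case `∅`, on the locus of Thm. 10.10 (b) — REFEREED (Yan–Zhu Cor. 2.9) -/

/-- **BSTW statement 9.10 (a), two-variable case, for `g = f_E` on the locus of Thm. 10.10 (b) / 10.5 is
REFEREED print**: under `Thm1010bHypotheses W p N K`, for ANY pair `(κ₁, κ₂)` with adapted generators,
`X(E/L_∞) = (W.baseChange K).XOrd₂ p κ₁ κ₂ γ₁ γ₂` is `Λ_L`-torsion — Yan–Zhu, J. Algebra 693 (2026),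
Cor. 2.9 (`cor29_XOrd₂_isTorsion`: `3 ≤ p` good ordinary split in `K`, `(N_E, D_K) = 1`, `E[p]|_{G_K}`
irreducible; flag-free: [Kato, 17.4] for `E`, `E^K` + [SU14, Prop. 3.9]). So the torsion conjunct of the
sibling binder `thm1010b_standardMainStatement_twoVariable_OPEN` carries no preprint content.
CONDITIONAL on the named refereed fact; closes nothing by itself.
[cite: YanZhu2024MainConjNonCM, Cor. 2.9 (arXiv:2412.20078v4 TeX l.628–633)]
[cite: BurungaleSkinnerTianWan2024, statement 9.10 (a) (p. 81) on the locus of Thm. 10.10 (b) (p. 89)] -/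
theorem xOrd₂_isTorsion_of_cor29 (h29 : cor29_XOrd₂_isTorsion) (W : WeierstrassCurve ℚ) [W.IsElliptic]
    [W.IsGloballyMinimal] {K : Type} [Field K] [NumberField K] (κ₁ κ₂ : ZpExtension K p)
    (γ₁ γ₂ : absoluteGaloisGroup K) [Fact (ZpExtension.IsTopGeneratorPair κ₁ κ₂ γ₁ γ₂)] {N : ℕ}
    (hyp : Thm1010bHypotheses W p N K) :
    Module.IsTorsion (IwasawaAlgebra₂ p) ((W.baseChange K).XOrd₂ p κ₁ κ₂ γ₁ γ₂) := by
  have hN : IsCoprime (W.conductorNorm ℤ : ℤ) (NumberField.discr K) := hyp.level ▸ hyp.coprime_level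
  exact h29 W K κ₁ κ₂ γ₁ γ₂ hyp.three_le hyp.goodOrd hyp.isImaginaryQuadratic hyp.split hN hyp.irrK

/-! ## §2. The Skinner–Urban step of the proof of Thm. 10.8 / 10.10 (b), with BOTH cyclotomic main
statements in the Néron normalisation (`CharIdealEqPadicLFunctionNeron`) as inputs -/

/-- **The two-variable upgrade "divisibility ⟹ equality" of BSTW's proof template (proof of Thm. 10.8,
pp. 88–89, tex l.7496–7510; Thm. 10.10 (b): "One may proceed just as in the proof of Theorem 10.8"),
for `g = f_E` at an ordinary prime, on the cyclotomic/anticyclotomic coordinates.** Inputs, step for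
printed step: "Since Theorem 10.3 applies to `g` as well as `g ⊗ χ_L`" ↦ the integral cyclotomic main
statements `CharIdealEqPadicLFunctionNeron W p` (`hE`) and `CharIdealEqPadicLFunctionNeron W' p` (`hEK`)
for a globally minimal model `W'` of `E^L = E^{(D_L)}` (any source: the 10.10 (a) binders, [SU14] via
`charIdealEqPadicLFunctionNeron_of_skinnerUrban_of_semistable`, …); "by Lemma 9.17" ↦ Yan–Zhu Lemma 5.3
(`h53`, Selmer side: some `G ∈ Char(X(E/L_∞))` reduces to `g_E · g_{E^L}` on the cyclotomic line) and
Prop. 3.7 at print strength (`h37`, analytic side: `𝓛⁺ = ι(u) · ϖϖ' · L_p(f_E, α) L_p(g, α')`); "the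
two-variable divisibility" ↦ `hdiv : Char(X) ⊂ (𝓛)` (`IdealLeSpan`; Thm. 10.5 — the gen-8 binder, or any
source); "noting the non-vanishing of `𝓛_p^{cyc}`" ↦ Rohrlich (`padicLFunction_unitRoot_ne_zero`, tree
theorem, for `f_E` and `g`); "(cf. [SU, Lem. 3.2])" ↦ `IwasawaAlgebra₂.spanLeIdeal_of_idealLeSpan_of_cycRestrict_eq`
(Skinner–Urban Lemma 3.1.7, tree theorem). Conclusion: `(𝓛) ⊂ Char(X)` (`SpanLeIdeal`) for the Hida
frame `F` of `hdiv`. Data: `(κ₁, κ₂)` THE cyclotomic/anticyclotomic pair of `K`, `κ` the cyclotomic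
`ℤ_p`-extension of `ℚ` with `γ₁|_{ℚ_∞}` its normalised generator (`IsCyclotomicVariable`), `π`/`π'`
modular parametrisations of `W`/`W'` at their conductors (their period ratios `ϖ, ϖ' ∈ ℚ`, Edixhoven,
`ModularParametrizationData.exists_rat_mul_realPeriodRat_eq_plusPeriod`, feed the Néron-normalised
statements; Selmer dual data over `ℚ_∞` exist, `nonempty_selmerDualData_holds`; the twisted model's
datum is transported to `W'` by `IsogenySelmerInfty.exists_selmerDualData_of_smul_eq`). This is the
`YanZhu2026.spanLeIdeal_perrinRiou_of_facts` argument of the (Im)-clause file with its two Kato inputs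
replaced by the Néron-normalised main statements — no (Im), no Heegner hypothesis.
[cite: BurungaleSkinnerTianWan2024, proof of Thm. 10.8 (pp. 88–89; tex l.7496–7510) and Thm. 10.10 (b) (p. 89, l.7528)]
[cite: YanZhu2024MainConjNonCM, Lemma 5.3 (arXiv:2412.20078v4 TeX l.1086–1093), Prop. 3.7 (l.821–829)]
[cite: SkinnerUrban2014, Lemma 3.1.7 (p. 20)] [cite: RohrlichInventiones1984, Theorem (p. 409)] -/
theorem spanLeIdeal_perrinRiou_of_idealLeSpan_of_charIdealEqNeron
    (h53 : lemma53_charIdeal_mul_charIdeal_le_toPlus_charIdeal)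
    (h37 : prop37_cycRestrict_perrinRiou_eq_padicLFunction_mul)
    (ι : integralClosure ℚ ℂ →+* ℂ_[p]) (W : WeierstrassCurve ℚ) [W.IsElliptic] [W.IsGloballyMinimal]
    (K : Type) [Field K] [NumberField K] (κ₁ κ₂ : ZpExtension K p) (γ₁ γ₂ : absoluteGaloisGroup K)
    [Fact (ZpExtension.IsTopGeneratorPair κ₁ κ₂ γ₁ γ₂)] {N : ℕ} [NeZero N]
    (π : ModularParametrizationData W N) (κ : ZpExtension ℚ p)
    (W' : WeierstrassCurve ℚ) [W'.IsElliptic] [W'.IsGloballyMinimal] [NeZero (W'.conductorNorm ℤ)]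
    (π' : ModularParametrizationData W' (W'.conductorNorm ℤ))
    (hlevel : (N : ℤ) = W.conductorNorm ℤ) (hp : 3 ≤ p) (hord : GoodOrd W p)
    (hK : IsImaginaryQuadratic K) (hsplit : ((Ideal.span {(p : ℤ)}).primesOver (𝓞 K)).ncard = 2)
    (hN : IsCoprime (N : ℤ) (NumberField.discr K))
    (hirrK : (W.baseChange K).HasIrreducibleModPGaloisRep p)
    (hκ₁ : κ₁.IsCyclotomic) (hκ₂ : κ₂.IsAnticyclotomic) (hκ : κ.IsCyclotomic)
    (hγ : κ.IsTopGenerator (absGaloisRestrict ℚ K γ₁))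
    (hγ' : IsCyclotomicVariable p (absGaloisRestrict ℚ K γ₁))
    (hW' : ∃ C : WeierstrassCurve.VariableChange ℚ, C • W' = W.quadraticTwist (NumberField.discr K : ℚ))
    (hord' : GoodOrd W' p)
    (hE : CharIdealEqPadicLFunctionNeron W p) (hEK : CharIdealEqPadicLFunctionNeron W' p)
    {F : CycAntiSeries p} (hF : IsHidaRankinLFunction ι W κ₁ κ₂ π.f F)
    (hdiv : IdealLeSpan (WeierstrassCurve.XOrd₂.charIdeal (W.baseChange K) p κ₁ κ₂ γ₁ γ₂)
      (perrinRiouLFunction W π F)) :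
    SpanLeIdeal (perrinRiouLFunction W π F)
      (WeierstrassCurve.XOrd₂.charIdeal (W.baseChange K) p κ₁ κ₂ γ₁ γ₂) := by
  obtain rfl : N = W.conductorNorm ℤ := by exact_mod_cast hlevel
  -- the period ratios `ϖ · Ω_E = Ω⁺_f`, `ϖ' · Ω_{E^L} = Ω⁺_g` are rational (Edixhoven)
  obtain ⟨ϖ, -, hϖ, -⟩ := π.exists_rat_mul_realPeriodRat_eq_plusPeriod
  obtain ⟨ϖ', -, hϖ', -⟩ := π'.exists_rat_mul_realPeriodRat_eq_plusPeriod
  -- Selmer dual data over `ℚ_∞` for `E` and for the twisted model `W^{(D_L)}`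
  obtain ⟨D⟩ := W.nonempty_selmerDualData_holds κ (absGaloisRestrict ℚ K γ₁) hγ
  obtain ⟨C, hC⟩ := hW'
  obtain ⟨D'⟩ := (W.quadraticTwist (NumberField.discr K : ℚ)).nonempty_selmerDualData_holds κ
    (absGaloisRestrict ℚ K γ₁) hγ
  -- the cyclotomic main statement for `E`: `Char(X(E/ℚ_∞)) = (g_E)`, `ι g_E = ϖ · L_p(f_E, α)`
  obtain ⟨-, gE, hDE, hgE⟩ := hE κ (absGaloisRestrict ℚ K γ₁) hκ hγ hγ' π.f π.isNewformOf ϖ hϖ D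
  have hgEmem : gE ∈ D.charIdeal := hDE ▸ Ideal.mem_span_singleton_self gE
  -- the cyclotomic main statement for `E^L` on the minimal model `W'`, transported to `W^{(D_L)}`
  obtain ⟨D'', hchar, -⟩ := IsogenySelmerInfty.exists_selmerDualData_of_smul_eq p hC D'
  obtain ⟨-, gK, hDK, hgK⟩ := hEK κ (absGaloisRestrict ℚ K γ₁) hκ hγ hγ' π'.f π'.isNewformOf ϖ' hϖ' D''
  have hgKmem : gK ∈ D'.charIdeal := hchar ▸ hDK ▸ Ideal.mem_span_singleton_self gK
  -- (Lemma 9.17 (i), Selmer side = Yan–Zhu Lemma 5.3): `G ∈ Char(X)` with `Ḡ = g_E · g_K`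
  obtain ⟨G, hGmem, hGeq⟩ := h53 W K κ₁ κ₂ γ₁ γ₂ κ (absGaloisRestrict ℚ K γ₁) D D' hp hord hK hsplit
    (by exact_mod_cast hN) hirrK hκ₁ hκ₂ hκ hγ hγ gE hgEmem gK hgKmem
  -- (Lemma 9.17 (i), analytic side = Yan–Zhu Prop. 3.7): `𝓛⁺ = ι(u) · ϖϖ' · L_p(f_E) L_p(g)`
  obtain ⟨u, hu⟩ := h37 ι W K κ₁ κ₂ γ₁ γ₂ π ϖ W' π'.f ϖ' hp hord hK hsplit hN hκ₁ hκ₂ hγ' hϖ ⟨C, hC⟩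
    π'.isNewformOf hϖ' F hF
  -- so `𝓛⁺ = ι(u · Ḡ)`
  have hGL : iwasawaToPowerSeries p (toPlus p G) =
      PowerSeries.C ((ϖ * ϖ' : ℚ) : ℚ_[p]) *
        (padicLFunction π.f (unitRoot W p : ℚ_[p]) * padicLFunction π'.f (unitRoot W' p : ℚ_[p])) := by
    rw [hGeq, map_mul, hgE, hgK, Rat.cast_mul, map_mul]
    ring
  have hL : cycRestrict (perrinRiouLFunction W π F) =
      iwasawaToPowerSeries p ((u : IwasawaAlgebra p) * toPlus p G) := by
    rw [hu, map_mul, hGL]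
  -- "noting the non-vanishing of `𝓛_p^{cyc}`" (Rohrlich)
  have hL0 : cycRestrict (perrinRiouLFunction W π F) ≠ 0 := by
    rw [hu]
    refine mul_ne_zero ((u.isUnit.map (iwasawaToPowerSeries p)).ne_zero) (mul_ne_zero ?_ (mul_ne_zero
      (padicLFunction_unitRoot_ne_zero ⟨hord.1, hord.2⟩ π.isNewformOf)
      (padicLFunction_unitRoot_ne_zero ⟨hord'.1, hord'.2⟩ π'.isNewformOf)))
    rw [Ne, PowerSeries.ext_iff, not_forall]
    refine ⟨0, ?_⟩
    rw [PowerSeries.coeff_C, if_pos rfl, map_zero]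
    exact_mod_cast mul_ne_zero (π.isNewformOf.periodRatio_ne_zero hϖ) (π'.isNewformOf.periodRatio_ne_zero hϖ')
  -- "(cf. [SU, Lem. 3.2])"
  exact spanLeIdeal_of_idealLeSpan_of_cycRestrict_eq hdiv hGmem hL hL0

/-! ## §3. The replay of Thm. 10.10 (b), statement 9.10 (`∅`) (b), reverse inclusion — from the
divisibility of Thm. 10.5 and the cyclotomic statements of Thm. 10.10 (a) -/

/-- **BSTW Thm. 10.10 (b), statement 9.10 (b) in the two-variable case, REVERSE INCLUSION
`(𝓛_p(g_{/L})) ⊂ ξ(X(g_{/L}))`, REPLAYED IN THE KERNEL** for `g = f_E` on the cyclotomic/anticyclotomic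
coordinates of `Λ_L` (with `γ₁|_{ℚ_∞}` the normalised cyclotomic generator), from: the two-variable
divisibility `Char(X) ⊂ (𝓛)` for the Hida frame `F` (`hdiv` — Thm. 10.5, `∘ = ∅`), the two 10.10 (a)
binders (`hO1` = `thm1010a_mainStatement_semistable_ordinary_OPEN` for `E`, `hO2` =
`thm1010_twist_mainStatement_OPEN` for `E^L = E^{(D_L)}`; BOTH derived from [SU14] in the tree —
`…_of_skinnerUrban` below), the refereed Yan–Zhu Lemma 5.3 / Prop. 3.7 (`h53`, `h37`), and modularity in
the form `nonempty_modularParametrizationData` (a parametrisation of the minimal model of `E^L`, for its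
newform and rational period ratio). Under `Thm1010bHypotheses W p N K` every side condition of these
inputs is DISCHARGED here: `D_L` square-free `≠ 1` with ramified primes `∣ D_L`, prime to `Np`
(`Thm1010bHypotheses.ramifiedInQuadratic_discr`); a globally minimal `W'` with `C • W' = W^{(D_L)}`
(`exists_isGloballyMinimal_smul_eq_quadraticTwist`), good ordinary at `p`
(`isOrdinaryAt_of_smul_eq_quadraticTwist_discr`); irreducibility over `K` from (irr_L). WEAKER than the
sibling 9.10-`∅` binder's `SpanLeIdeal` clause by exactly: the pair `(κ₁, κ₂)` is THE
cyclotomic/anticyclotomic one and `γ₁` restricts to the cyclotomic variable (the binder allows any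
adapted pair). CONDITIONAL on the named binders/facts; closes nothing by itself.
[claim: BurungaleSkinnerTianWan2024, status: under-review]
[cite: BurungaleSkinnerTianWan2024, Thm. 10.10 (b) (p. 89; tex l.7523–7528) with its proof template, proof of Thm. 10.8 (pp. 88–89, l.7496–7510), and Thm. 10.5 (pp. 87–88)]
[cite: YanZhu2024MainConjNonCM, Lemma 5.3, Prop. 3.7 (arXiv:2412.20078v4 TeX l.1086–1093, l.821–829)]
[cite: SkinnerUrban2014, Lemma 3.1.7 (p. 20)] -/
theorem spanLeIdeal_perrinRiou_of_idealLeSpan_of_thm1010_OPEN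
    (hO1 : thm1010a_mainStatement_semistable_ordinary_OPEN) (hO2 : thm1010_twist_mainStatement_OPEN)
    (h53 : lemma53_charIdeal_mul_charIdeal_le_toPlus_charIdeal)
    (h37 : prop37_cycRestrict_perrinRiou_eq_padicLFunction_mul)
    (hmodpar : nonempty_modularParametrizationData)
    (ι : integralClosure ℚ ℂ →+* ℂ_[p]) (W : WeierstrassCurve ℚ) [W.IsElliptic] [W.IsGloballyMinimal]
    (K : Type) [Field K] [NumberField K] (κ₁ κ₂ : ZpExtension K p) (γ₁ γ₂ : absoluteGaloisGroup K)
    [Fact (ZpExtension.IsTopGeneratorPair κ₁ κ₂ γ₁ γ₂)] {N : ℕ} [NeZero N]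
    (π : ModularParametrizationData W N) (hyp : Thm1010bHypotheses W p N K)
    (hκ₁ : κ₁.IsCyclotomic) (hκ₂ : κ₂.IsAnticyclotomic) (κ : ZpExtension ℚ p) (hκ : κ.IsCyclotomic)
    (hγ : κ.IsTopGenerator (absGaloisRestrict ℚ K γ₁))
    (hγ' : IsCyclotomicVariable p (absGaloisRestrict ℚ K γ₁))
    {F : CycAntiSeries p} (hF : IsHidaRankinLFunction ι W κ₁ κ₂ π.f F)
    (hdiv : IdealLeSpan (WeierstrassCurve.XOrd₂.charIdeal (W.baseChange K) p κ₁ κ₂ γ₁ γ₂)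
      (perrinRiouLFunction W π F)) :
    SpanLeIdeal (perrinRiouLFunction W π F)
      (WeierstrassCurve.XOrd₂.charIdeal (W.baseChange K) p κ₁ κ₂ γ₁ γ₂) := by
  have hd0 : (NumberField.discr K : ℚ) ≠ 0 := by exact_mod_cast NumberField.discr_ne_zero K
  obtain ⟨hsq, hne1, -⟩ := hyp.discr_squarefree
  -- a globally minimal model `W'` of `E^L = E^{(D_L)}` with a modular parametrisation
  obtain ⟨W', hW'e, hW'm, C, hC⟩ := exists_isGloballyMinimal_smul_eq_quadraticTwist W hd0
  haveI := hW'e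
  haveI := hW'm
  haveI : NeZero (W'.conductorNorm ℤ) := ⟨(W'.conductorNorm_pos_holds).ne'⟩
  obtain ⟨π'⟩ := hmodpar W'
  -- `W'` is good ordinary at `p` (`p ∤ 2 D_L`)
  have hord' : GoodOrd W' p := by
    have h := isOrdinaryAt_of_smul_eq_quadraticTwist_discr hyp.isImaginaryQuadratic.finrank_eq_two W W'
      hC p hyp.two_ne hyp.not_dvd_discr ⟨hyp.goodOrd.1, hyp.goodOrd.2⟩
    exact ⟨h.1, h.2⟩
  -- the two cyclotomic main statements (Thm. 10.10 (a) for `g` and for `g ⊗ χ_L`)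
  have hE : CharIdealEqPadicLFunctionNeron W p :=
    hO1 W p hyp.two_ne hyp.semistable hyp.goodOrd.1 hyp.goodOrd.2 hyp.irrQ
  have hEK : CharIdealEqPadicLFunctionNeron W' p :=
    hO2 W W' p (NumberField.discr K) C hyp.two_ne hyp.semistable hyp.goodOrd.1 hyp.goodOrd.2 hyp.irrQ
      hsq hne1 (fun q _ hq ↦ hyp.ramifiedInQuadratic_discr q hq) hC
  exact spanLeIdeal_perrinRiou_of_idealLeSpan_of_charIdealEqNeron h53 h37 ι W K κ₁ κ₂ γ₁ γ₂ π κ W' π'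
    hyp.level hyp.three_le hyp.goodOrd hyp.isImaginaryQuadratic hyp.split hyp.coprime_level hyp.irrK
    hκ₁ hκ₂ hκ hγ hγ' ⟨C, hC⟩ hord' hE hEK hF hdiv

/-- **The same, with the two Thm. 10.10 (a) binders DISCHARGED from refereed print** ([SU14]
Thm. 3.6.9 `hSU` = bsd.S21 `skinner_urban_main_conj…` universally, the Greenberg–Vatsal period-unit
facts `h5`, `h3`, modularity `hmod`, Ribet–Diamond level-lowering `hLL`) through the ARM-P reader's
theorems `thm1010a_mainStatement_semistable_ordinary_OPEN_of_skinnerUrban` and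
`thm1010_twist_mainStatement_OPEN_of_skinnerUrban`: on the locus of Thm. 10.10 (b) the reverse
inclusion of 9.10 (`∅`) follows from Thm. 10.5 (`∘ = ∅`) and REFEREED inputs only (the [SU14] input
carries the cell's `p = 3` proof-input flag `SU14-12.3.6-mu@nonsplit@3`, as everywhere in the tree).
CONDITIONAL; closes nothing by itself. [claim: BurungaleSkinnerTianWan2024, status: under-review]
[cite: BurungaleSkinnerTianWan2024, Thm. 10.10 (b) and Rem. 10.11 (p. 89; tex l.7519–7533)]
[cite: SkinnerUrban2014, Thm. 3.6.9 and the remark before Cor. 3.6.10 (p. 45); Lemma 3.1.7 (p. 20)] -/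
theorem spanLeIdeal_perrinRiou_of_idealLeSpan_of_skinnerUrban
    (hSU : ∀ (W : WeierstrassCurve ℚ) [W.IsElliptic] [W.IsGloballyMinimal] (p : ℕ) [Fact p.Prime]
      (κ : ZpExtension ℚ p) (γ : Field.absoluteGaloisGroup ℚ) (N : ℕ) [NeZero N]
      (f : CuspForm (Gamma0 N) 2),
      skinner_urban_main_conjecture W p (κ := κ) (γ := γ) (f := f))
    (h5 : realPeriodRat_eq_unit_mul_plusPeriod) (h3 : realPeriodRat_eq_unit_mul_plusPeriod_three)
    (hmod : exists_isNewformOf) (hLL : diamond1995_refinedSerre)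
    (h53 : lemma53_charIdeal_mul_charIdeal_le_toPlus_charIdeal)
    (h37 : prop37_cycRestrict_perrinRiou_eq_padicLFunction_mul)
    (hmodpar : nonempty_modularParametrizationData)
    (ι : integralClosure ℚ ℂ →+* ℂ_[p]) (W : WeierstrassCurve ℚ) [W.IsElliptic] [W.IsGloballyMinimal]
    (K : Type) [Field K] [NumberField K] (κ₁ κ₂ : ZpExtension K p) (γ₁ γ₂ : absoluteGaloisGroup K)
    [Fact (ZpExtension.IsTopGeneratorPair κ₁ κ₂ γ₁ γ₂)] {N : ℕ} [NeZero N]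
    (π : ModularParametrizationData W N) (hyp : Thm1010bHypotheses W p N K)
    (hκ₁ : κ₁.IsCyclotomic) (hκ₂ : κ₂.IsAnticyclotomic) (κ : ZpExtension ℚ p) (hκ : κ.IsCyclotomic)
    (hγ : κ.IsTopGenerator (absGaloisRestrict ℚ K γ₁))
    (hγ' : IsCyclotomicVariable p (absGaloisRestrict ℚ K γ₁))
    {F : CycAntiSeries p} (hF : IsHidaRankinLFunction ι W κ₁ κ₂ π.f F)
    (hdiv : IdealLeSpan (WeierstrassCurve.XOrd₂.charIdeal (W.baseChange K) p κ₁ κ₂ γ₁ γ₂)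
      (perrinRiouLFunction W π F)) :
    SpanLeIdeal (perrinRiouLFunction W π F)
      (WeierstrassCurve.XOrd₂.charIdeal (W.baseChange K) p κ₁ κ₂ γ₁ γ₂) :=
  spanLeIdeal_perrinRiou_of_idealLeSpan_of_thm1010_OPEN
    (thm1010a_mainStatement_semistable_ordinary_OPEN_of_skinnerUrban hSU h5 h3 hmod hLL)
    (thm1010_twist_mainStatement_OPEN_of_skinnerUrban hSU h5 h3 hmod hLL) h53 h37 hmodpar ι W K κ₁ κ₂ γ₁
    γ₂ π hyp hκ₁ hκ₂ κ hκ hγ hγ' hF hdiv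

/-! ## §4. "In particular Conj[.] Greenberg is true for `· = ∅`" (proof of Thm. 10.8, last line:
"a consequence of Proposition 9.20") — statement 9.12 (`∅`) from 9.10 (`∅`) through the refereed
Yan–Zhu Thm. 4.7 at `S = {1}` and BCS25 Thm. 4.1.3 -/

/-- **BSTW Thm. 10.10 (b), statement 9.12 (two-variable Greenberg main statement, case `∅`), from
statement 9.10 (`∅`) — the last step of the proof template ("the `In particular' part is a consequence
of Proposition 9.20", tex l.7513), REPLAYED IN THE KERNEL with Prop. 9.20's REFEREED incarnations**:
Yan–Zhu Thm. 4.7 at `S = {1}` (`h47`: both inclusions transfer ord ↔ Gr; "essentially [BSTW,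
Prop. 9.18]") and BCS25 Thm. 4.1.3 (`h413`: torsion transfers ord → Gr), plus Yan–Zhu Cor. 2.9 (`h29`,
torsion of `X_ord`). Given, for ONE congruence-integral Hida frame `F`, both inclusions of 9.10 (`∅`) (b)
(`hle`, `hge`), under `Thm1010bHypotheses W p N K` with `D_L ≠ −3` (the one field of Yan–Zhu's
`GreenbergSetting` the block lacks), the `ι`-prime data `(v, v̄)`, THE cyclotomic/anticyclotomic pair:
for every Katz/Greenberg frame `(LK, G)` at the inverse generators and every structure-compatible `J`,
`X_Gr = (W.baseChange K).XGr₂ p κ₁ κ₂ v̄ γ₁ γ₂` is torsion and `char(X_Gr)𝒪_{ℂ_p}⟦T₁,T₂⟧ = (G)` —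
EXACTLY the conclusion shape of the sibling binder `thm1010b_greenbergMainStatement_twoVariable_OPEN`
(for the frame's newform `π.f`). WEAKER than that binder by exactly `D_L ≠ −3`. CONDITIONAL; closes
nothing by itself. [claim: BurungaleSkinnerTianWan2024, status: under-review]
[cite: BurungaleSkinnerTianWan2024, Thm. 10.10 (b) (p. 89) with statement 9.12 (p. 81; l.6935–6944) and the proof of Thm. 10.8, last sentence (tex l.7513)]
[cite: YanZhu2024MainConjNonCM, Thm. 4.7 (arXiv:2412.20078v4 TeX l.1022–1034), Cor. 2.9 (l.628–633)]
[cite: BurungaleCastellaSkinner2025, Thm. 4.1.3 (§4.1, p. 8 of arXiv:2405.00270v2)] -/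
theorem greenbergMainStatement_twoVariable_of_idealLeSpan_of_spanLeIdeal
    (h47 : thm47_ord_localised_iff_greenbergAnyRoot_localised)
    (h413 : thm413_ord_torsion_dvd_iff_greenberg_torsion_dvd) (h29 : cor29_XOrd₂_isTorsion)
    (ι₁ : integralClosure ℚ ℂ →+* ℂ_[p]) (ι : PadicAlgCl p ≃+* ℂ) (W : WeierstrassCurve ℚ) [W.IsElliptic]
    [W.IsGloballyMinimal] (K : Type) [Field K] [NumberField K] (v vbar : HeightOneSpectrum (𝓞 K))
    (κ₁ κ₂ : ZpExtension K p) (γ₁ γ₂ : absoluteGaloisGroup K)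
    [Fact (ZpExtension.IsTopGeneratorPair κ₁ κ₂ γ₁ γ₂)] {N : ℕ} [NeZero N]
    (π : ModularParametrizationData W N) [NeZero (NumberField.discr K).natAbs]
    (hyp : Thm1010bHypotheses W p N K) (hv : ((p : ℕ) : 𝓞 K) ∈ v.asIdeal)
    (hvbar : ((p : ℕ) : 𝓞 K) ∈ vbar.asIdeal) (hne : vbar ≠ v)
    (hcompat : ∀ (w : InfinitePlace K) (k : 𝓞 K), k ∈ v.asIdeal ↔ ‖ι.symm (w.embedding (k : K))‖ < 1)
    (hκ₁ : κ₁.IsCyclotomic) (hκ₂ : κ₂.IsAnticyclotomic) (hD3 : NumberField.discr K ≠ -3)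
    (hι : ∀ z : integralClosure ℚ ℂ, ι₁ z = ((ι.symm (z : ℂ) : PadicAlgCl p) : ℂ_[p]))
    {F : CycAntiSeries p} (hF : IsHidaRankinLFunction ι₁ W κ₁ κ₂ π.f F) (hcF : IsCongruenceIntegral π.f F)
    (hle : IdealLeSpan (WeierstrassCurve.XOrd₂.charIdeal (W.baseChange K) p κ₁ κ₂ γ₁ γ₂)
      (perrinRiouLFunction W π F))
    (hge : SpanLeIdeal (perrinRiouLFunction W π F)
      (WeierstrassCurve.XOrd₂.charIdeal (W.baseChange K) p κ₁ κ₂ γ₁ γ₂))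
    {Ω δ : ℂ} {Ωp : (unrIntegers p)ˣ} {LK G : PowerSeries (PowerSeries (PadicComplexInt p))}
    (hLK : IsKatzMeasure₂ ι v vbar ∅ κ₁ κ₂ γ₁⁻¹ γ₂⁻¹ 1 Ω δ ((Ωp : unrIntegers p) : ℂ_[p]) LK)
    (hG : IsGreenbergLFunctionAnyRoot₂ ι v vbar κ₁ κ₂ γ₁⁻¹ γ₂⁻¹ π.f (NumberField.discr K).natAbs
      (NumberField.classNumber K) LK G)
    (J : ℤ_[p] →+* PadicComplexInt p)
    (hJ : ∀ x : ℤ_[p], ((J x : PadicComplexInt p) : ℂ_[p]) = ((x : ℚ_[p]) : ℂ_[p])) :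
    Module.IsTorsion (IwasawaAlgebra₂ p) ((W.baseChange K).XGr₂ p κ₁ κ₂ vbar γ₁ γ₂) ∧
      (WeierstrassCurve.XGr₂.charIdeal (W.baseChange K) p κ₁ κ₂ vbar γ₁ γ₂).map (toUnr₂ p J) =
        Ideal.span {G} := by
  have hset : GreenbergSetting ι W N K v vbar κ₁ κ₂ :=
    { level := hyp.level, three_le := hyp.three_le, goodOrd := hyp.goodOrd,
      isImaginaryQuadratic := hyp.isImaginaryQuadratic, split := hyp.split, mem_v := hv,
      mem_vbar := hvbar, vbar_ne := hne, compat := hcompat, coprime := hyp.coprime_level,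
      discr_odd := hyp.discr_odd, discr_ne := hD3, cyclotomic := hκ₁, anticyclotomic := hκ₂ }
  have htor : Module.IsTorsion (IwasawaAlgebra₂ p) ((W.baseChange K).XOrd₂ p κ₁ κ₂ γ₁ γ₂) :=
    xOrd₂_isTorsion_of_cor29 h29 W κ₁ κ₂ γ₁ γ₂ hyp
  refine ⟨xGr₂_isTorsion_of_thm413 ι₁ ι W v vbar κ₁ κ₂ γ₁ γ₂ π h413 hset hyp.irrK hι hF hcF hLK hG hJ
    htor hle, le_antisymm ?_ ?_⟩
  · have h := (h47 ι₁ ι W K v vbar κ₁ κ₂ γ₁ γ₂ π hset hyp.irrK hι F hF hcF Ω δ Ωp LK G hLK hG J hJ 1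
      one_ne_zero).1
    rw [idealLeSpanAway_one_iff, map_one, exists_span_one_pow_mul_le_iff] at h
    exact h.mp hle
  · exact span_le_charIdealXGr₂_map_of_spanLeIdeal h47 ι₁ ι W K v vbar κ₁ κ₂ γ₁ γ₂ π hset hyp.irrK hι
      hF hcF hLK hG J hJ hge

end Literature.NumberTheory.EllipticCurves.BurungaleSkinnerTianWan2024

end
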